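import Mathlib
import HarnessLib
import Summits.HubbardSuperconductivity.HubbardSuperconductivity.Theorems.KLProgrammeKLRegimeSectorSliceGramFat
import Summits.HubbardSuperconductivity.HubbardSuperconductivity.Theorems.KLProgrammeH10TwoPointLimitSectorMultiplierOverlapRegime
import Summits.HubbardSuperconductivity.HubbardSuperconductivity.Theorems.KLProgrammeKLRegimeEngineV8DefsU4
import Summits.HubbardSuperconductivity.HubbardSuperconductivity.Theorems.KLProgrammeKLRegimeWickOrderedStep

/-!
# Route `KLProgramme` — ENGINE child stmt-HubbardSuperconductivity-20236 `KLRegimeEngineV16`, `stub_engine_step_norms` / `stub_engine_step_values`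
# (E.5 `CR` classes): the sector-resolved ENTRY bound `κ²` and the Gram constant of the FAT-sectorised slice lines IN THE KL REGIME, keyed by
# `FrameOK`, for EVERY slice below the family's scale (pairing-robust)

Cell gate-hubbard-kl, seat hubbard-kl-k3c2-p3 (g4, row «sector-counting import (DR2000 L11/L12) for the leg-dress bar»).  Companion of
…SectorSliceGramFat (g3: `norm_entry_sliceCT_bgmFat_le`, `isGramBoundedR_sliceCT_bgmFat`, `gramConst_sq_bgmFat_closed`) in the key of p4's
…SectorMultiplierOverlapRegime: the frame data of the fat pack (`B = bandBounds (−6/5) (−1/10)`, frame `C²` size `A := κ₀/4`,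
`κ₀ = min (min (Dt_min/4) (ρ_min/4)) (1/40)`, zone margin `1/10`, cutoff-profile constant `d` of `exists_abs_derivs_bgmCutoffSq_le`) are discharged
from `FrameOK R U (nScales β) μ K`, `μ ∈ klWindowC`, `klBetaMin ≤ β ≤ e^{c/U²}` and the thresholds on `c`, `U`; the scale facts (`π ≤ Λ_m β`,
`2^{m+1} ≤ L`, `L·Λ_m ≥ πβ`) from `m ≤ nScales β`, `β² ≤ L`.  For the lines `C′ = S(Ft)ᵀ·C^K_{(Λ,Λ′]}·S(Ft)`, `Ft = bgmFatMultiplier … klE0 … (m+1)`,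
and ANY slice with `0 < Λ ≤ Λ′`, `Λ ≤ Λ_{m+1} = klScale klE0 (m+1)` (the index bookkeeping of SECTOR-RADIAL-ALIGNMENT.md, evidence #13 on 20236:
an `hsupp`-consistent step pairs the fat family of index `k` with slices of index `≥ k+2`, so the slice scale must be FREE below the family's):

* `isGramBoundedR_of_le` — monotonicity of the replica-Gram constant; `cQ_le_one`, `cRhomin_le_two` — `ρ_min ≤ 2` on any band window;
* **`gram_entry_sliceCT_bgmFat_of_thresholds`** — `∃ Cκ > 0` (absolute): in the regime, for every `m ≤ nScales β` and every such slice,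
  `‖C′(Y,Y′)‖ ≤ Cκ·(Λ_{m+1}/Λ)·e₀·8^{-(m+1)}` and `IsGramBoundedR C′ √(Cκ·(Λ_{m+1}/Λ)·e₀·8^{-(m+1)})` (BGM (2.80): `γ^{3h/2}`, times the shift `Λ_{m+1}/Λ`);
* **`gram_entry_sliceCT_bgmFat_klEng`**, **`gram_entry_klSliceCov_bgmFat_klEng`** — the same under EXACTLY the binders of the gen-6 engine stubs
  (`P.WF`, `R.WF2`, `0 < c ≤ klEngC₃3 P R`, `0 < U ≤ klEngU₀4 P R c`, `klEngL₃ β U ≤ L`, `klEngM₃ β U L ≤ M`), the second one for the engine's own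
  slices `klSliceCov L M β μ K n′`, `n ≤ n′`: `‖(S(Ft_n)ᵀ·g_{n′}·S(Ft_n))(Y,Y′)‖ ≤ Cκ·(Λ_n/Λ_{n′})·e₀·8^{-n}`.

Everything is proved; no definitions, no named facts.  References (locators only): Benfatto–Giuliani–Mastropietro, Ann. Henri Poincaré 7 (2006)
§2.7 (2.66)–(2.67), §2.8 (2.80); Disertori–Rivasseau, Comm. Math. Phys. 215 (2000) §IV.2 Lemma 11.
-/

noncomputable section

namespace Summit.HubbardSuperconductivity.HubbardSuperconductivity.Theorems.TorusFourierL2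

set_option linter.dupNamespace false -- summit = problem name (single-conjunct summit), D-0017

open Set Finset Literature.MathematicalPhysics.QuantumLattice Literature.MathematicalPhysics.QuantumLattice.BandSectorCounting
open Literature.MathematicalPhysics.QuantumLattice.FermiRG Literature.Probability.LatticeModels Literature.Analysis.SpecialFunctions
open Summit.HubbardSuperconductivity.HubbardSuperconductivity.Theorems.DispersionFlow
open Summit.HubbardSuperconductivity.HubbardSuperconductivity.Theorems.KLRegimeSplit
open Summit.HubbardSuperconductivity.HubbardSuperconductivity.Theorems.KLProgrammeLegKernels
open Summit.HubbardSuperconductivity.HubbardSuperconductivity.Theorems.PerturbedFermiCurve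
open Summit.HubbardSuperconductivity.HubbardSuperconductivity.Theorems.KLRegimeWick
open scoped Real

/-! ## §0 Two generic facts -/

universe u in
/-- **Monotonicity of the replica-Gram constant**: `IsGramBoundedR C κ`, `0 ≤ κ ≤ κ′ ⇒ IsGramBoundedR C κ′`. [folklore] -/
theorem isGramBoundedR_of_le {𝕜 : Type*} [RCLike 𝕜] {Γ : Type u} [Fintype Γ] [DecidableEq Γ] {C : Matrix Γ Γ 𝕜} {κ κ' : ℝ}
    (h : IsGramBoundedR C κ) (hκ : 0 ≤ κ) (hle : κ ≤ κ') : IsGramBoundedR C κ' := by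
  intro Γ' _ _ e n U hU N Z
  exact (h e n U hU N Z).trans (pow_le_pow_left₀ hκ hle N)

/-- `q_b = sin K_b / K_b ≤ 1` (`K_b > 0`). [folklore] -/
theorem cQ_le_one {b : ℝ} (hb : -4 < b) : cQ b ≤ 1 := by
  unfold cQ
  have hx := umklappRadius_pos hb
  rw [div_le_one hx]
  exact Real.sin_le hx.le

/-- `ρ_min = q_b·√(a+4) ≤ 2` for `-4 < b`, `a ≤ 0`. [folklore] -/
theorem cRhomin_le_two {a b : ℝ} (ha0 : a ≤ 0) (hb : -4 < b) : cRhomin a b ≤ 2 := by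
  unfold cRhomin cUmin
  have h1 := cQ_le_one hb
  have h2 : Real.sqrt (a + 4) ≤ 2 := by
    rw [show (2 : ℝ) = Real.sqrt (2 ^ 2) by rw [Real.sqrt_sq (by norm_num)]]
    exact Real.sqrt_le_sqrt (by linarith)
  calc cQ b * Real.sqrt (a + 4) ≤ 1 * 2 := mul_le_mul h1 h2 (Real.sqrt_nonneg _) zero_le_one
    _ = 2 := one_mul _

/-! ## §1 `κ²` and the Gram constant in the KL regime, absolute thresholds exposed -/

/-- **The sector-resolved entry bound and Gram constant of the fat-sectorised slice lines in the KL regime** (thresholds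
`κ₀ = min (min (Dt_min/4) (ρ_min/4)) (1/40)` of `B = bandBounds (−6/5) (−1/10)` EXPOSED, as in p4's `overlap_sums_klAniso_bgmFat_of_thresholds`):
there is an absolute `Cκ > 0` such that for every `R` (`Gfr ≥ 0`), `0 < c ≤ κ₀/(12(Gfr₂+1))`, `0 < U ≤ min 1 (κ₀/(24(Gfr₀+Gfr₁+1)))`,
`klBetaMin ≤ β ≤ e^{c/U²}`, `μ ∈ klWindowC`, `FrameOK R U (nScales β) μ K`, `β² ≤ L`, every `m ≤ nScales β` and every slice `0 < Λ ≤ Λ′` with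
`Λ ≤ klScale klE0 (m+1)`: each entry of `S(Ft)ᵀ·C^K_{(Λ,Λ′]}·S(Ft)` (`Ft = bgmFatMultiplier … klE0 … (m+1)`) is
`≤ Cκ·(klScale klE0 (m+1)/Λ)·(klE0·8^{-(m+1)})`, and the matrix is replica-Gram-bounded with the square root of that number.
[cite: BenfattoGiulianiMastropietro2006, §2.8 (2.80)] -/
theorem gram_entry_sliceCT_bgmFat_of_thresholds (ha : (-4 : ℝ) < -(6 / 5)) (hab : (-(6 / 5) : ℝ) ≤ -(1 / 10)) (hb : (-(1 / 10) : ℝ) < 0) :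
    ∃ Cκ : ℝ, 0 < Cκ ∧ ∀ (R : RenConsts), (∀ j, 0 ≤ R.Gfr j) →
      ∀ (c U : ℝ), 0 < c →
      c ≤ min (min ((bandBounds ha hab hb).Dtmin / 4) ((bandBounds ha hab hb).rhomin / 4)) (1 / 40) / (12 * (R.Gfr 2 + 1)) → 0 < U →
      U ≤ min 1 (min (min ((bandBounds ha hab hb).Dtmin / 4) ((bandBounds ha hab hb).rhomin / 4)) (1 / 40) / (24 * (R.Gfr 0 + R.Gfr 1 + 1))) →
      ∀ β : ℝ, klBetaMin ≤ β → β ≤ Real.exp (c / U ^ 2) → ∀ μ ∈ klWindowC, ∀ K : TrigPolyC4v, FrameOK R U (nScales β) μ K →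
      ∀ (L M : ℕ) [NeZero L] [NeZero M], β ^ 2 ≤ (L : ℝ) → ∀ m : ℕ, m ≤ nScales β →
      ∀ Λ Λ' : ℝ, 0 < Λ → Λ ≤ Λ' → Λ ≤ klScale klE0 (m + 1) →
        (∀ Y Y' : SpaceTimeIdx L M × SectorLeg (sectorCount (m + 1)),
          ‖((sectorSubMatrix L M β (bgmFatMultiplier L M klE0 β (nambuXiCT L μ K) (m + 1))).transpose *
              hubbardCovSliceCT L M β μ 0 K Λ Λ' * sectorSubMatrix L M β (bgmFatMultiplier L M klE0 β (nambuXiCT L μ K) (m + 1))) Y Y'‖ ≤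
            Cκ * (klScale klE0 (m + 1) / Λ) * (klE0 * ((8 : ℝ) ^ (m + 1))⁻¹)) ∧
        IsGramBoundedR ((sectorSubMatrix L M β (bgmFatMultiplier L M klE0 β (nambuXiCT L μ K) (m + 1))).transpose *
              hubbardCovSliceCT L M β μ 0 K Λ Λ' * sectorSubMatrix L M β (bgmFatMultiplier L M klE0 β (nambuXiCT L μ K) (m + 1)))
          (Real.sqrt (Cκ * (klScale klE0 (m + 1) / Λ) * (klE0 * ((8 : ℝ) ^ (m + 1))⁻¹))) := by
  -- the window band bounds and the absolute frame-size threshold (as in p4's `overlap_sums_klAniso_bgmFat_of_thresholds`)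
  set B : BandBounds (-(6 / 5)) (-(1 / 10)) := bandBounds ha hab hb with hBdef
  set κ₀ : ℝ := min (min (B.Dtmin / 4) (B.rhomin / 4)) (1 / 40) with hκ₀
  have hDt := B.Dtmin_pos
  have hrh := B.rhomin_pos
  have hκ₀pos : 0 < κ₀ := by rw [hκ₀]; exact lt_min (lt_min (by positivity) (by positivity)) (by norm_num)
  have hκ₀Dt : κ₀ ≤ B.Dtmin / 4 := (min_le_left _ _).trans (min_le_left _ _)
  have hκ₀rh : κ₀ ≤ B.rhomin / 4 := (min_le_left _ _).trans (min_le_right _ _)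
  have hκ₀40 : κ₀ ≤ 1 / 40 := min_le_right _ _
  have hrh2 : B.rhomin ≤ 2 := by
    have : B.rhomin = cRhomin (-(6 / 5)) (-(1 / 10)) := rfl
    rw [this]; exact cRhomin_le_two (by norm_num) (by norm_num)
  -- the cutoff-profile constant
  have he : (0 : ℝ) < klE0 := by norm_num [klE0]
  obtain ⟨d₀, hd₀, hd₀1, hd₀2⟩ := exists_abs_derivs_bgmCutoffSq_le he
  -- the absolute constant
  set A : ℝ := κ₀ / 4 with hAdef
  have hA0 : 0 < A := by rw [hAdef]; positivity
  have hDtA : 0 < B.Dtmin - 2 * A := by rw [hAdef]; linarith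
  have hγ : 0 < 2 * B.rhomin - 4 * A := by rw [hAdef]; linarith
  have hγ4 : 2 * B.rhomin - 4 * A ≤ 4 := by linarith
  have hsm := B.smax_pos
  have hπ := Real.pi_pos
  have hπ3 := Real.pi_gt_three
  obtain ⟨cρ, hcρ⟩ : ∃ cρ : ℝ, cρ = (2 * klE0 / π + B.smax * B.Dtmin * (3 / 4)) / (B.Dtmin - 2 * A) +
      π * Real.sqrt 2 * (1 + (4 + 2 * A) / (B.Dtmin - 2 * A)) := ⟨_, rfl⟩
  obtain ⟨Kp, hKp⟩ : ∃ Kp : ℝ, Kp = 4 + 4 * A := ⟨_, rfl⟩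
  obtain ⟨c₁, hc₁⟩ : ∃ c₁ : ℝ, c₁ = 4 + Kp * cρ ^ 2 * π ^ 2 / klE0 := ⟨_, rfl⟩
  obtain ⟨CN, hCN⟩ : ∃ CN : ℝ, CN = 128 * c₁ * cρ / (π ^ 2 * (2 * B.rhomin - 4 * A)) := ⟨_, rfl⟩
  have hcρ0 : 0 < cρ := by rw [hcρ]; positivity
  have hKp0 : 0 < Kp := by rw [hKp]; positivity
  have hc₁0 : 0 < c₁ := by rw [hc₁]; positivity
  have hCN0 : 0 < CN := by rw [hCN]; positivity
  refine ⟨2 * CN, by positivity, ?_⟩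
  intro R hR c U hc hcle hU hUle β hβmin hβc μ hμ K hK L M _ _ hLβ m hmN Λ Λ' hΛ hΛΛ' hΛg
  have hβ0 : 0 < β := pos_of_klBetaMin_le hβmin
  have hβ128 : 128 ≤ β := by simpa [klBetaMin] using hβmin
  have hL0 : (0 : ℝ) < L := lt_of_lt_of_le (by positivity) hLβ
  -- the frame's `C²` size is `≤ A = κ₀/4`
  have hlog : 1 ≤ Real.log 4 := by
    have h4 : Real.exp 1 ≤ 4 := by have := Real.exp_one_lt_d9; norm_num at this; linarith
    calc (1 : ℝ) = Real.log (Real.exp 1) := (Real.log_exp 1).symm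
      _ ≤ Real.log 4 := Real.log_le_log (Real.exp_pos 1) h4
  have hAK : ∀ p : Momentum, ∀ j ≤ 2, ‖iteratedFDeriv ℝ j (frameShift K) p‖ ≤ A := by
    intro p j hj
    refine (norm_iteratedFDeriv_frameShift_le_of_frameOK_regime hR hc.le hβmin hβc hK p hj).trans ?_
    have h0 := hR 0; have h1 := hR 1; have h2 := hR 2
    have hU1 : U ≤ 1 := hUle.trans (min_le_left _ _)
    have hUk : U ≤ κ₀ / (24 * (R.Gfr 0 + R.Gfr 1 + 1)) := hUle.trans (min_le_right _ _)
    rw [abs_of_pos hU]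
    have hU2 : U ^ 2 ≤ U := by nlinarith only [hU, hU1]
    have hA1 : 2 * R.Gfr 0 * U + 2 * R.Gfr 1 * U ^ 2 ≤ 2 * (R.Gfr 0 + R.Gfr 1 + 1) * U := by
      have := mul_le_mul_of_nonneg_left hU2 h1
      linarith only [this, hU.le]
    have hB1 : 2 * (R.Gfr 0 + R.Gfr 1 + 1) * U ≤ κ₀ / 12 := by
      have hpos : 0 < 24 * (R.Gfr 0 + R.Gfr 1 + 1) := by positivity
      have := (le_div_iff₀ hpos).mp hUk
      linarith only [this]
    have hC1 : R.Gfr 2 * (c / Real.log 4) ≤ R.Gfr 2 * c := mul_le_mul_of_nonneg_left (div_le_self hc.le hlog) h2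
    have hD1 : R.Gfr 2 * c ≤ κ₀ / 12 := by
      have hpos : 0 < 12 * (R.Gfr 2 + 1) := by positivity
      have := (le_div_iff₀ hpos).mp hcle
      linarith only [this, hc.le]
    rw [hAdef]; linarith only [hA1, hB1, hC1, hD1, hκ₀pos]
  -- the window margins
  have hμ' := hμ
  simp only [klWindowC, Set.mem_Icc] at hμ'
  have e1 : (-1.05 : ℝ) = -(21 / 20) := by norm_num
  have e2 : (-0.15 : ℝ) = -(3 / 20) := by norm_num
  have hμlo : -(21 / 20 : ℝ) ≤ μ := by rw [← e1]; exact hμ'.1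
  have hμhi : μ ≤ -(3 / 20 : ℝ) := by rw [← e2]; exact hμ'.2
  have he0 : klE0 = 1 / 32 := rfl
  have hgap : klE0 + A + (1 / 10 : ℝ) ^ 2 < -μ := by rw [he0, hAdef]; linarith only [hμhi, hκ₀40]
  have h3 : klE0 + A - μ ≤ 3 := by rw [he0, hAdef]; linarith only [hμlo, hκ₀40]
  have hlo : (-(6 / 5) : ℝ) ≤ μ - A - klE0 := by rw [he0, hAdef]; linarith only [hμlo, hκ₀40]
  have hhi : μ + A + klE0 ≤ -(1 / 10) := by rw [he0, hAdef]; linarith only [hμhi, hκ₀40]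
  have hADt : 2 * A < B.Dtmin := by rw [hAdef]; linarith
  have hρA : 4 * A < 2 * B.rhomin := by rw [hAdef]; linarith
  -- the scales: `Λg = Λ_{m+1}`, `Λ_m = 4Λg`, `N_r = 2^{m+1}`, `N_r²Λg = e₀`
  set Λg : ℝ := klScale klE0 (m + 1) with hΛgdef
  set Nr : ℝ := (2 : ℝ) ^ (m + 1) with hNrdef
  have hΛg0 : 0 < Λg := klth_klScale_pos (m + 1)
  have hNr2 : 2 ≤ Nr := by
    rw [hNrdef]
    calc (2 : ℝ) = 2 ^ 1 := by norm_num
      _ ≤ 2 ^ (m + 1) := pow_le_pow_right₀ (by norm_num) (by omega)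
  have hNr0 : 0 < Nr := by linarith only [hNr2]
  have hNrsq : Nr ^ 2 = (4 : ℝ) ^ (m + 1) := by
    rw [hNrdef, ← pow_mul, show (4 : ℝ) = 2 ^ 2 by norm_num, ← pow_mul]; ring_nf
  have hNrΛ : Nr ^ 2 * Λg = klE0 := by rw [hNrsq, hΛgdef, klScale]; field_simp
  have hΛm : klScale klE0 m = 4 * Λg := by rw [hΛgdef, klScale, klScale, pow_succ]; field_simp
  have hNrΛ' : Nr * Λg ≤ klE0 / 2 := by
    have : Nr * Λg = klE0 / Nr := by
      rw [eq_div_iff hNr0.ne', ← hNrΛ]; ring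
    rw [this]; exact div_le_div_of_nonneg_left he.le (by norm_num) hNr2
  have hw : sectorWidth (m + 1) = π / Nr := by rw [sectorWidth, hNrdef]
  -- `π ≤ Λ_m β` (`m ≤ n_β`), `2^{m+1} ≤ β ≤ L`, `L·Λ_m ≥ πβ`
  have hanti : ∀ {a b : ℕ}, a ≤ b → klScale klE0 b ≤ klScale klE0 a := fun hab' => by
    unfold klScale; exact mul_le_mul_of_nonneg_left (inv_anti₀ (by positivity) (pow_le_pow_right₀ (by norm_num) hab')) he.le
  have hΛmβ : π / β ≤ klScale klE0 m := (klth_pi_div_le_klScale_nScales hβmin).trans (hanti hmN)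
  have hπβ : π ≤ klScale klE0 m * β := by
    have := mul_le_mul_of_nonneg_right hΛmβ hβ0.le
    rwa [div_mul_cancel₀ _ hβ0.ne'] at this
  have hπβ' : π ≤ 4 * Λg * β := by rw [← hΛm]; exact hπβ
  have h4m : (4 : ℝ) ^ m ≤ klE0 * β / π := by
    -- from `π/β ≤ Λ_m = e₀·(4^m)⁻¹`
    have h4pos : (0 : ℝ) < (4 : ℝ) ^ m := by positivity
    have h1 : π / β ≤ klE0 * ((4 : ℝ) ^ m)⁻¹ := by simpa [klScale] using hΛmβ
    rw [le_div_iff₀ hπ]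
    rw [div_le_iff₀ hβ0] at h1
    have : π * (4 : ℝ) ^ m ≤ klE0 * ((4 : ℝ) ^ m)⁻¹ * β * (4 : ℝ) ^ m := mul_le_mul_of_nonneg_right h1 h4pos.le
    have e : klE0 * ((4 : ℝ) ^ m)⁻¹ * β * (4 : ℝ) ^ m = klE0 * β := by field_simp
    linarith only [this, e]
  have hNrβ : Nr ≤ β := by
    have h2le4 : Nr ≤ 2 * (4 : ℝ) ^ m := by
      rw [hNrdef, pow_succ, mul_comm]
      exact mul_le_mul_of_nonneg_left (pow_le_pow_left₀ (by norm_num) (by norm_num) m) (by norm_num)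
    have h' : 2 * (klE0 * β / π) ≤ β := by
      rw [he0, mul_div_assoc', div_le_iff₀ hπ]; nlinarith only [hπ3, hβ0]
    linarith only [h2le4, h4m, h']
  have hNrL : Nr ≤ (L : ℝ) := hNrβ.trans ((le_self_pow₀ (by linarith only [hβ128]) two_ne_zero).trans hLβ)
  have hLΛm : π * β ≤ (L : ℝ) * klScale klE0 m := by
    have h1 : π / β * β ^ 2 ≤ klScale klE0 m * (L : ℝ) := mul_le_mul hΛmβ hLβ (by positivity) (klth_klScale_pos m).le
    have e : π / β * β ^ 2 = π * β := by field_simp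
    linarith only [h1, e]
  -- the cell radius `ρ_f ≤ c_ρ π / N_r` and the shell thickness (as in `slicePair_bgmFat_closed`)
  set ρf : ℝ := (klScale klE0 m + B.smax * B.Dtmin * (3 * sectorWidth (m + 1) / 4)) / (B.Dtmin - 2 * A) +
    π * Real.sqrt 2 * (1 + (4 + 2 * A) / (B.Dtmin - 2 * A)) * sectorWidth (m + 1) with hρf
  have hΛm0 : 0 < klScale klE0 m := klth_klScale_pos m
  have hρf0 : 0 ≤ ρf := by rw [hρf]; have := sectorWidth_pos (m + 1); positivity
  have hρfb : ρf ≤ cρ * π / Nr := by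
    rw [hρf, hcρ, hw, hΛm]
    have h4Λ : 4 * Λg ≤ 2 * klE0 / π * (π / Nr) := by
      have e : 2 * klE0 / π * (π / Nr) = 2 * klE0 / Nr := by field_simp
      rw [e, le_div_iff₀ hNr0]
      have := mul_le_mul_of_nonneg_left hNrΛ' (by norm_num : (0:ℝ) ≤ 4)
      linarith only [this]
    have e2 : ((2 * klE0 / π + B.smax * B.Dtmin * (3 / 4)) / (B.Dtmin - 2 * A) + π * Real.sqrt 2 * (1 + (4 + 2 * A) / (B.Dtmin - 2 * A))) * π / Nr =
        (2 * klE0 / π * (π / Nr) + B.smax * B.Dtmin * (3 * (π / Nr) / 4)) / (B.Dtmin - 2 * A) +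
          π * Real.sqrt 2 * (1 + (4 + 2 * A) / (B.Dtmin - 2 * A)) * (π / Nr) := by
      field_simp
    rw [e2]
    gcongr
  have hsh : klScale klE0 m + Kp * ρf ^ 2 ≤ Λg * c₁ := by
    rw [hΛm, hc₁]
    have h1 : ρf ^ 2 ≤ (cρ * π / Nr) ^ 2 := pow_le_pow_left₀ hρf0 hρfb 2
    have h2 : Kp * ρf ^ 2 ≤ Kp * (cρ * π / Nr) ^ 2 := mul_le_mul_of_nonneg_left h1 hKp0.le
    have e : Λg * (4 + Kp * cρ ^ 2 * π ^ 2 / klE0) = 4 * Λg + Kp * (cρ * π / Nr) ^ 2 := by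
      rw [← hNrΛ]; field_simp
    rw [e]; linarith only [h2]
  have hKρ : 0 ≤ Kp * ρf ^ 2 := by positivity
  -- the two `+2` thresholds
  have hρfw : π * Real.sqrt 2 * (π / Nr) ≤ ρf := by
    rw [hρf, hw]
    have h1 : 0 ≤ (klScale klE0 m + B.smax * B.Dtmin * (3 * (π / Nr) / 4)) / (B.Dtmin - 2 * A) := by
      have := klth_klScale_pos m; positivity
    have h2 : π * Real.sqrt 2 * (π / Nr) ≤ π * Real.sqrt 2 * (1 + (4 + 2 * A) / (B.Dtmin - 2 * A)) * (π / Nr) := by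
      have hx : (1 : ℝ) ≤ 1 + (4 + 2 * A) / (B.Dtmin - 2 * A) := le_add_of_nonneg_right (by positivity)
      have h0 : 0 ≤ π * Real.sqrt 2 * (π / Nr) := by positivity
      calc π * Real.sqrt 2 * (π / Nr) = π * Real.sqrt 2 * 1 * (π / Nr) := by ring
        _ ≤ π * Real.sqrt 2 * (1 + (4 + 2 * A) / (B.Dtmin - 2 * A)) * (π / Nr) := by gcongr
    linarith only [h1, h2]
  have hs2 : Real.sqrt 2 * Real.sqrt 2 = 2 := Real.mul_self_sqrt (by norm_num)
  have hY₂ : 2 ≤ Real.sqrt 2 * L * (2 * ρf) / π := by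
    rw [le_div_iff₀ hπ]
    have h1 : Real.sqrt 2 * L * (2 * (π * Real.sqrt 2 * (π / Nr))) ≤ Real.sqrt 2 * L * (2 * ρf) := by gcongr
    have e : Real.sqrt 2 * L * (2 * (π * Real.sqrt 2 * (π / Nr))) = 4 * π * (π * L / Nr) := by
      have : Real.sqrt 2 * L * (2 * (π * Real.sqrt 2 * (π / Nr))) = (Real.sqrt 2 * Real.sqrt 2) * 2 * π * (π * L / Nr) := by ring
      rw [this, hs2]; ring
    have h2 : 2 * π ≤ 4 * π * (π * L / Nr) := by
      have hx : 1 ≤ π * L / Nr := by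
        rw [le_div_iff₀ hNr0, one_mul]; nlinarith only [hNrL, hπ3, hL0]
      nlinarith only [hx, hπ]
    linarith only [h1, e, h2]
  have hY₁ : 2 ≤ Real.sqrt 2 * L * ((klScale klE0 m + Kp * ρf ^ 2) / (2 * B.rhomin - 4 * A)) / π := by
    rw [le_div_iff₀ hπ]
    have h1 : klScale klE0 m / 4 ≤ (klScale klE0 m + Kp * ρf ^ 2) / (2 * B.rhomin - 4 * A) := by
      rw [div_le_div_iff₀ (by norm_num) hγ]
      have := klth_klScale_pos m
      nlinarith only [hγ4, hKρ, this]
    have h2 : Real.sqrt 2 * L * (klScale klE0 m / 4) ≤ Real.sqrt 2 * L * ((klScale klE0 m + Kp * ρf ^ 2) / (2 * B.rhomin - 4 * A)) := by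
      gcongr
    have hs1 : 1 ≤ Real.sqrt 2 := by
      rw [show (1 : ℝ) = Real.sqrt 1 by simp]; exact Real.sqrt_le_sqrt (by norm_num)
    have h3 : 2 * π ≤ Real.sqrt 2 * L * (klScale klE0 m / 4) := by
      have : 2 * π ≤ 1 * ((L : ℝ) * klScale klE0 m) / 4 := by nlinarith only [hLΛm, hβ128, hπ]
      calc 2 * π ≤ 1 * ((L : ℝ) * klScale klE0 m) / 4 := this
        _ ≤ Real.sqrt 2 * ((L : ℝ) * klScale klE0 m) / 4 := by gcongr
        _ = Real.sqrt 2 * L * (klScale klE0 m / 4) := by ring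
    linarith only [h2, h3]
  -- the closed form of the support count (…SectorSliceGramFat, pure real algebra)
  have hG := gramConst_sq_bgmFat_closed (Λ := Λg) (Λm := klScale klE0 m) (β := β) (L := (L : ℝ)) (γ := 2 * B.rhomin - 4 * A)
    (Kp := Kp) (ρf := ρf) (cρ := cρ) (c₁ := c₁) (Nr := Nr) hΛg0 hβ0 hL0 hγ hNr0 hc₁0.le hΛm hπβ hsh hρfb hKρ hY₁ hY₂
  -- the entry bound at the slice `(Λ, Λ′]`, then the shift `Λg/Λ`
  have hnorm : ‖((1 / (β * (L : ℝ) ^ 2) : ℝ) : ℂ)‖ ^ 2 = (1 / (β * (L : ℝ) ^ 2)) ^ 2 := by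
    rw [Complex.norm_real, Real.norm_eq_abs, abs_of_pos (by positivity)]
  have hE : ‖((1 / (β * (L : ℝ) ^ 2) : ℝ) : ℂ)‖ ^ 2 *
      ((klScale klE0 m * β / π + 1) *
        ((Real.sqrt 2 * L * ((klScale klE0 m + (4 + 4 * A) * ρf ^ 2) / (2 * B.rhomin - 4 * A)) / π + 2) *
          (Real.sqrt 2 * L * (2 * ρf) / π + 2)) * (2 * (β * (L : ℝ) ^ 2) / Λ)) ≤
      2 * CN * (Λg / Λ) * (klE0 * ((8 : ℝ) ^ (m + 1))⁻¹) := by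
    rw [hnorm, ← hKp]
    have e1 : (1 / (β * (L : ℝ) ^ 2)) ^ 2 *
        ((klScale klE0 m * β / π + 1) *
          ((Real.sqrt 2 * L * ((klScale klE0 m + Kp * ρf ^ 2) / (2 * B.rhomin - 4 * A)) / π + 2) *
            (Real.sqrt 2 * L * (2 * ρf) / π + 2)) * (2 * (β * (L : ℝ) ^ 2) / Λ)) =
        (1 / (β * (L : ℝ) ^ 2)) ^ 2 *
        ((klScale klE0 m * β / π + 1) *
          ((Real.sqrt 2 * L * ((klScale klE0 m + Kp * ρf ^ 2) / (2 * B.rhomin - 4 * A)) / π + 2) *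
            (Real.sqrt 2 * L * (2 * ρf) / π + 2)) * (2 * (β * (L : ℝ) ^ 2) / Λg)) * (Λg / Λ) := by
      field_simp
    rw [e1]
    have e2 : Λg / Nr = klE0 * ((8 : ℝ) ^ (m + 1))⁻¹ := by rw [hΛgdef, hNrdef]; exact klScale_div_two_pow klE0 m
    have hG' : (1 / (β * (L : ℝ) ^ 2)) ^ 2 *
        ((klScale klE0 m * β / π + 1) *
          ((Real.sqrt 2 * L * ((klScale klE0 m + Kp * ρf ^ 2) / (2 * B.rhomin - 4 * A)) / π + 2) *
            (Real.sqrt 2 * L * (2 * ρf) / π + 2)) * (2 * (β * (L : ℝ) ^ 2) / Λg)) ≤ 2 * CN * (klE0 * ((8 : ℝ) ^ (m + 1))⁻¹) := by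
      rw [← e2, hCN]
      calc _ ≤ 2 * (128 * c₁ * cρ / (π ^ 2 * (2 * B.rhomin - 4 * A))) * Λg / Nr := hG
        _ = 2 * (128 * c₁ * cρ / (π ^ 2 * (2 * B.rhomin - 4 * A))) * (Λg / Nr) := by ring
    have hr0 : 0 ≤ Λg / Λ := by positivity
    calc _ ≤ 2 * CN * (klE0 * ((8 : ℝ) ^ (m + 1))⁻¹) * (Λg / Λ) := mul_le_mul_of_nonneg_right hG' hr0
      _ = 2 * CN * (Λg / Λ) * (klE0 * ((8 : ℝ) ^ (m + 1))⁻¹) := by ring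
  refine ⟨fun Y Y' => ?_, ?_⟩
  · exact (norm_entry_sliceCT_bgmFat_le (L := L) (M := M) B hAK hADt he (by norm_num : (0 : ℝ) < 1 / 10) (by norm_num : (1 / 10 : ℝ) ≤ 1)
      hgap h3 hlo hhi hβ0 hρA m hd₀ hd₀1 hd₀2 hΛ hΛΛ' Y Y').trans hE
  · have hGB := isGramBoundedR_sliceCT_bgmFat (L := L) (M := M) B hAK hADt he (by norm_num : (0 : ℝ) < 1 / 10) (by norm_num : (1 / 10 : ℝ) ≤ 1)
      hgap h3 hlo hhi hβ0 hρA m hd₀ hd₀1 hd₀2 hΛ hΛΛ'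
    exact isGramBoundedR_of_le hGB (Real.sqrt_nonneg _) (Real.sqrt_le_sqrt hE)

/-! ## §2 Under EXACTLY the binders of the gen-6 engine stubs (`klEngC₃3 / klEngU₀4 / klEngL₃ / klEngM₃`) -/

/-- **`κ²` / Gram constant under the binders of `stub_engine_step_norms` / `stub_engine_step_values`**, for the fat family of index `m+1`,
`m ≤ nScales β`, and ANY slice `0 < Λ ≤ Λ′`, `Λ ≤ klScale klE0 (m+1)`: entries `≤ Cκ·(Λ_{m+1}/Λ)·e₀·8^{-(m+1)}` and the `IsGramBoundedR` twin —
the package thresholds are below the absolute ones (`klEngC₃3_le_symbolC₃`, `klEngU₀4_le_klEngU₀3`, `klEngU₀3_le_symbolU₀`), `Gfr ≥ 0` by `R.WF2`,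
`β² ≤ L` by `sq_le_of_klEngL₃_le`. [cite: BenfattoGiulianiMastropietro2006, §2.8 (2.80)] -/
theorem gram_entry_sliceCT_bgmFat_klEng :
    ∃ Cκ : ℝ, 0 < Cκ ∧ ∀ (P : SplitConsts) (R : RenConsts) (c : ℝ), P.WF → R.WF2 → 0 < c → c ≤ EngineV8.klEngC₃3 P R →
      ∀ μ ∈ klWindowC, ∀ U : ℝ, 0 < U → U ≤ EngineV8.klEngU₀4 P R c → ∀ β : ℝ, klBetaMin ≤ β → β ≤ Real.exp (c / U ^ 2) →
      ∀ K : TrigPolyC4v, FrameOK R U (nScales β) μ K → ∀ (L M : ℕ) [NeZero L] [NeZero M],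
      EngineV8.klEngL₃ β U ≤ L → EngineV8.klEngM₃ β U L ≤ M → ∀ m : ℕ, m ≤ nScales β →
      ∀ Λ Λ' : ℝ, 0 < Λ → Λ ≤ Λ' → Λ ≤ klScale klE0 (m + 1) →
        (∀ Y Y' : SpaceTimeIdx L M × SectorLeg (sectorCount (m + 1)),
          ‖((sectorSubMatrix L M β (bgmFatMultiplier L M klE0 β (nambuXiCT L μ K) (m + 1))).transpose *
              hubbardCovSliceCT L M β μ 0 K Λ Λ' * sectorSubMatrix L M β (bgmFatMultiplier L M klE0 β (nambuXiCT L μ K) (m + 1))) Y Y'‖ ≤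
            Cκ * (klScale klE0 (m + 1) / Λ) * (klE0 * ((8 : ℝ) ^ (m + 1))⁻¹)) ∧
        IsGramBoundedR ((sectorSubMatrix L M β (bgmFatMultiplier L M klE0 β (nambuXiCT L μ K) (m + 1))).transpose *
              hubbardCovSliceCT L M β μ 0 K Λ Λ' * sectorSubMatrix L M β (bgmFatMultiplier L M klE0 β (nambuXiCT L μ K) (m + 1)))
          (Real.sqrt (Cκ * (klScale klE0 (m + 1) / Λ) * (klE0 * ((8 : ℝ) ^ (m + 1))⁻¹))) := by
  have ha : (-4 : ℝ) < -(6 / 5) := by norm_num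
  have hab : (-(6 / 5) : ℝ) ≤ -(1 / 10) := by norm_num
  have hb : (-(1 / 10) : ℝ) < 0 := by norm_num
  obtain ⟨Cκ, hCκ, h⟩ := gram_entry_sliceCT_bgmFat_of_thresholds ha hab hb
  refine ⟨Cκ, hCκ, ?_⟩
  intro P R c _ hR2 hc hc3 μ hμ U hU hU0 β hβmin hβc K hK L M _ _ hL3 _ m hmN Λ Λ' hΛ hΛΛ' hΛg
  have hRj : ∀ j, 0 ≤ R.Gfr j := EngineV8.gfr_nonneg_of_wf2 hR2
  exact h R hRj c U hc (hc3.trans (EngineV8.klEngC₃3_le_symbolC₃ ha hab hb P hRj)) hU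
    ((hU0.trans (EngineV8.klEngU₀4_le_klEngU₀3 P R c)).trans (EngineV8.klEngU₀3_le_symbolU₀ ha hab hb P hRj c)) β hβmin hβc μ hμ K hK L M
    (EngineV8.sq_le_of_klEngL₃_le hL3) m hmN Λ Λ' hΛ hΛΛ' hΛg

/-- **The engine's own slices**: under the stub binders, for `1 ≤ n ≤ nScales β + 1` and every `n′ ≥ n`, the fat family of index `n` against the
slice `g_{n′} = klSliceCov L M β μ K n′ = C^K_{(Λ_{n′}, Λ_{n′−1}]}`:
`‖(S(Ft_n)ᵀ·g_{n′}·S(Ft_n))(Y,Y′)‖ ≤ Cκ·(Λ_n/Λ_{n′})·e₀·8^{-n}` and the `IsGramBoundedR` twin (`Λ_n/Λ_{n′} = 4^{n′−n}`; by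
SECTOR-RADIAL-ALIGNMENT an `hsupp`-consistent step uses `n′ ≥ n + 2`). [cite: BenfattoGiulianiMastropietro2006, §2.8 (2.80)] -/
theorem gram_entry_klSliceCov_bgmFat_klEng :
    ∃ Cκ : ℝ, 0 < Cκ ∧ ∀ (P : SplitConsts) (R : RenConsts) (c : ℝ), P.WF → R.WF2 → 0 < c → c ≤ EngineV8.klEngC₃3 P R →
      ∀ μ ∈ klWindowC, ∀ U : ℝ, 0 < U → U ≤ EngineV8.klEngU₀4 P R c → ∀ β : ℝ, klBetaMin ≤ β → β ≤ Real.exp (c / U ^ 2) →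
      ∀ K : TrigPolyC4v, FrameOK R U (nScales β) μ K → ∀ (L M : ℕ) [NeZero L] [NeZero M],
      EngineV8.klEngL₃ β U ≤ L → EngineV8.klEngM₃ β U L ≤ M → ∀ n : ℕ, 1 ≤ n → n ≤ nScales β + 1 → ∀ n' : ℕ, n ≤ n' →
        (∀ Y Y' : SpaceTimeIdx L M × SectorLeg (sectorCount n),
          ‖((sectorSubMatrix L M β (bgmFatMultiplier L M klE0 β (nambuXiCT L μ K) n)).transpose *
              klSliceCov L M β μ K n' * sectorSubMatrix L M β (bgmFatMultiplier L M klE0 β (nambuXiCT L μ K) n)) Y Y'‖ ≤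
            Cκ * (klScale klE0 n / klScale klE0 n') * (klE0 * ((8 : ℝ) ^ n)⁻¹)) ∧
        IsGramBoundedR ((sectorSubMatrix L M β (bgmFatMultiplier L M klE0 β (nambuXiCT L μ K) n)).transpose *
              klSliceCov L M β μ K n' * sectorSubMatrix L M β (bgmFatMultiplier L M klE0 β (nambuXiCT L μ K) n))
          (Real.sqrt (Cκ * (klScale klE0 n / klScale klE0 n') * (klE0 * ((8 : ℝ) ^ n)⁻¹))) := by
  obtain ⟨Cκ, hCκ, h⟩ := gram_entry_sliceCT_bgmFat_klEng
  refine ⟨Cκ, hCκ, ?_⟩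
  intro P R c hP hR2 hc hc3 μ hμ U hU hU0 β hβmin hβc K hK L M _ _ hL3 hM3 n hn hnN n' hnn'
  obtain ⟨m, rfl⟩ : ∃ m, n = m + 1 := ⟨n - 1, by omega⟩
  have he : (0 : ℝ) < klE0 := by norm_num [klE0]
  have hanti : ∀ {a b : ℕ}, a ≤ b → klScale klE0 b ≤ klScale klE0 a := fun hab' => by
    unfold klScale; exact mul_le_mul_of_nonneg_left (inv_anti₀ (by positivity) (pow_le_pow_right₀ (by norm_num) hab')) he.le
  exact h P R c hP hR2 hc hc3 μ hμ U hU hU0 β hβmin hβc K hK L M hL3 hM3 m (by omega) (klScale klE0 n') (klScale klE0 (n' - 1))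
    (klth_klScale_pos n') (hanti (Nat.sub_le n' 1)) (hanti hnn')

end Summit.HubbardSuperconductivity.HubbardSuperconductivity.Theorems.TorusFourierL2

end
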